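import Summits.ABC.IUTFork.Cor312SettingPrVol
import Summits.ABC.IUTFork.Cor312ThetaFiniteDHVol
import HarnessLib

/-!
# [IUTchIII] Corollary 3.12, statement — "`−|log(Θ)|` is finite" for the real setting with the PACKET-NORMALISED
# verbatim volumes: `HullDefined` at every `(j, v_ℚ)` and `ThetaFinite` from transparent Θ-box conditions

PROOF-ONLY record file (D-0012; no definitions) of the abc-iut cell (Cor. 3.12 sub-crew, seat abc-iut-c312-7, gen 3;
D-0067 TEAM A row A-0 «finiteness + BridgeHyps at the real setting», coda «A-0 AT THE PRINT-NORMALISED SETTING»);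
TAKES NO SIDE. abc-iut-c312-1 (gen 5) found (F-c312-1-g5-1, kernel certificate `Real.logvol_p_mul_DH` in
`Thm311RealDegreeFull`) that the constant-weighted container `Real.summandPiecesDH` of abc-iut-c312-5's assembled
setting of record `Real.settingDHVol` pairs [IUTchIII] Rmk. 3.1.1 (ii)'s normalized weight `1/[F:ℚ]^{j+1}` (kurims
`paper:url-4b091feeb646` p. 94, third display) with the NORMALISED summand log-measure `log μ̄ = log μ/dim` of
Dupuy–Hilado Def. 3.6.1 / [IUTchIV] Prop. 1.4 (i) p. 13 ("normalized so that `μ^log((R_E)^∼) = 0`,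
`μ^log(p·(R_E)^∼) = −log(p)`"), so that the printed normalisation sentence (p. 94: "normalized so that multiplication
by `p_{v_ℚ}` affects log-volumes by addition or subtraction … of the quantity `log(p_{v_ℚ})`") fails at every prime
that is not totally split in `F`, and built the PACKET-NORMALISED twin `Real.settingPrVol` (`Cor312SettingPrVol`,
p419741: abc-iut-c312-7's `Setting.ofComparison` over `Real.situationPrVol`, container `Real.summandPiecesPr` with the
probability weights `Pr(v⃗) = Π_a n_{v_a}/[F:ℚ]^{j+1}` of Dupuy–Hilado §3.6). THIS file re-points abc-iut-c312-5 (gen 3)'s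
A-0 side-condition chain `Cor312HullDefinedDHVol` / `Cor312ThetaFiniteDHVol` to that setting — the first clause
"`−|log(Θ)| ∈ ℝ`" of Cor. 3.12 (p. 174 l. 16; proof p. 175 l. 2–4 "one concludes easily from the [easily verified]
compactness of the `^{1,∘}𝒰_{j,v_ℚ}` … that the quantity `−|log(Θ)|` is finite") for `Real.settingPrVol`:

* §1 the (Ind3)-region of the assembled setting IS `e⁻¹(⋃ₘ Θ-boxes)`, with image `⋃ₘ Θ-boxes` at a prime;
* §2 `hullDefined_settingPrVol_inl` (at `∞`, UNCONDITIONALLY: empty field-factor index) and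
  `hullDefined_settingPrVol_inr` (at `p`, from BOUNDED and NONDEGENERATE Θ-boxes): the frames, the glue and the
  indeterminacy group of `settingPrVol` do not read the weights, so abc-iut-c312-5's absorbing log-shell lattices
  `e⁻¹(Π_{v⃗} c·I_{v⃗})` (`Cor312VolumesPadicLattice(Bounds)`: `exists_latticeF_of_norm_le`, `family_image_latticePk` —
  Dupuy–Hilado §4 "fixes the lattice") feed this seat's generic `Setting.hullDefined_of_stable` (p408515) verbatim;
  `thetaLocal_ne_top_settingPrVol`, `thetaHull_adm_settingPrVol`;
* §3 GOOD PRIMES (`p > 2`, `p ∤ disc(F)`, `j ∈ 𝔽_l^⋇`, boxes `= 𝒪_L`): the hull of the union of ALL possible images is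
  `e⁻¹(Π_{v⃗} (R_{v⃗})^∼)` ([IUTchIV] Thm. 1.10 Step (vi) p. 29 "the “container of possible images” is precisely equal to
  the tensor product of log-shells") and the local Θ-volume is `0` FOR THE PROBABILITY WEIGHTS TOO (every summand
  has `log μ̄((R_{v⃗})^∼) = 0`, so any weighting gives `0`): `thetaHull_settingPrVol_eq_of_good`,
  `thetaLocal_settingPrVol_eq_zero`;
* §4 **`thetaFinite_settingPrVol`**: this seat's `ThetaFinite` (`Cor312Statement`, FROZEN) for `Real.settingPrVol` from
  the same three Θ-box conditions as abc-iut-c312-5's `thetaFinite_settingDHVol` (bounded, nondegenerate at every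
  `(j ∈ 𝔽_l^⋇, p)`; equal to the unit polydisc off a finite prime set).

Every weight-free ingredient is CITED BY NAME from abc-iut-c312-5's files (`factorMapDH_inr_surjective`,
`preimage_factorMapDH_hullSet_one`, `absRamificationIdx_presAt_eq_one`, `two_le_card_caps_labelSucc`,
`finite_primes_dvd`, `good_of_not_dvd`), nothing is restated; the box conditions themselves are the box provider's
statement (abc-iut-c312-3 `Cor312ThetaBoxesDH`/`Cor312PilotIdelesDH`; companion `Cor312PilotIdelesPr` supplies them
for the sharp Dupuy–Hilado boxes read off ideles). [claim: Mochizuki2012, status: disputed] for the quoted sentences;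
[cite: DupuyHilado2025, §3.6, §4 (intro), §4.10]; [cite: Mochizuki2012, IUTchIV Prop. 1.4 (i) p. 13, Thm 1.10 proof
Step (vi) p. 29]. HONEST FRAMING: bookkeeping at the real carriers; no edit to any landed file; nothing here bears
on the truth of [IUTchIII] Cor. 3.12 (`Cor312.Setting.Statement` untouched). typed ≠ proved; instantiated ≠ endorsed.
-/

noncomputable section

open Set Function NumberField IsDedekindDomain Bornology
open scoped Pointwise

namespace Summit.ABC

namespace IUTFork

namespace Thm311

namespace Real

open Cor312 Cor312Vol Literature.IUT.LogThetaLattice Literature.IUT.LogVolume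

variable {F : Type} [Field F] [NumberField F] (X : PilotData F) {logv : PadicLogs F} (hlog : LogvAnalytic logv)

section Setting

variable (M : Type) [Field M] [NumberField M]
  (archPk : ∀ (j : (thetaIndex X).Label) (vQ : (thetaIndex X).VQ), Set ((logShellsDH X logv).Packet j vQ))
  (archSub : ∀ (j : (thetaIndex X).Label) (v : (thetaIndex X).V),
    Set ((logShellsDH X logv).Packet j ((thetaIndex X).over v)))
  (Ψ : ℤ → ∀ v : (thetaIndex X).V, v ∈ (thetaIndex X).Vbad → Set ((logShellsDH X logv).StarPacket v))
  (act : ℤ → ∀ v : (thetaIndex X).V, v ∈ (thetaIndex X).Vbad →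
    (logShellsDH X logv).StarPacket v → Module.End ℚ ((logShellsDH X logv).StarPacket v))
  (Mmod : ℤ → ∀ j : (thetaIndex X).LabelStar, Set ((logShellsDH X logv).GlobalPacket j.1))
  (region : ℤ → ∀ j : (thetaIndex X).LabelStar, FinDivisor M → ∀ vQ : (thetaIndex X).VQ,
    Set ((logShellsDH X logv).Packet j.1 vQ))
  (n : ℤ) {HT : Type} {LogLink : HT → HT → Type} {IsFull : ∀ {s t : HT}, LogLink s t → Prop}
  (lat : LGPGaussianLogThetaLattice LogLink IsFull)
  {Frd : Type} {IsoF : Frd → Frd → Type} {Ob : Frd → Type} {realify : Frd → Frd} {Strip : Type}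
  {IsoS : Strip → Strip → Type} {Mv : ∀ v : (thetaIndex X).V, v ∈ (thetaIndex X).Vbad → Type}
  [∀ v h, Monoid (Mv v h)]
  (sig : GlobalLGPFrobenioidSignature (thetaIndex X).lstar (thetaIndex X).V (· ∈ (thetaIndex X).Vbad)
    Frd IsoF Ob realify Strip IsoS Mv)
  (split : SplittingMonoids Mv) {ObΔ : Type} {N : ∀ v : (thetaIndex X).V, v ∈ (thetaIndex X).Vbad → Type}
  [∀ v h, Monoid (N v h)] (qData : QPilotData ObΔ N)
  (thetaBox : ℤ → Ob sig.Clgp → ∀ (j : (thetaIndex X).Label) (vQ : (thetaIndex X).VQ),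
    Set (∀ s : factorIdxDH X hlog j vQ, factorFieldDH X hlog j vQ s))
  (qCentre : ObΔ → ∀ (j : (thetaIndex X).Label) (vQ : (thetaIndex X).VQ),
    ∀ s : factorIdxDH X hlog j vQ, factorFieldDH X hlog j vQ s)
  (hq : ∀ j vQ s, qCentre (qPilotObject qData) j vQ s ≠ 0)
  (hfin : ∀ j : (thetaIndex X).Label, (Function.support fun vQ =>
    ((situationPrVol X hlog M archPk archSub Ψ act Mmod region).D n).logvol j vQ
      (factorMapDH X hlog j vQ ⁻¹' hullSet (factorFieldDH X hlog j vQ) (qCentre (qPilotObject qData) j vQ))).Finite)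

/-! ## 1. The (Ind3)-region of the assembled setting is `e⁻¹(⋃ₘ Θ-boxes)` -/

/-- The (Ind3)-enlarged Θ-region of `settingPrVol` at `(j, v_ℚ)` IS the preimage under the field-factor comparison of
the union over `m` of the Θ-boxes of the Θ-pilot object (this seat's `ofComparison_thetaRegion`, per `m`; the glue
does not read the weights). [folklore] -/
theorem thetaRegion3_settingPrVol (j : (thetaIndex X).Label) (vQ : (thetaIndex X).VQ) :
    (settingPrVol X hlog M archPk archSub Ψ act Mmod region n lat sig split qData thetaBox qCentre hq
      hfin).thetaRegion3 j vQ =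
      factorMapDH X hlog j vQ ⁻¹' ⋃ m : ℤ, thetaBox m (thetaPilotObject sig split) j vQ := by
  rw [Set.preimage_iUnion]
  rfl

/-- At a prime, the image of the (Ind3)-region under the field-factor comparison IS the union of the Θ-boxes
(`factorMapDH` is onto, abc-iut-c312-5 `factorMapDH_inr_surjective`). [folklore] -/
theorem image_thetaRegion3_settingPrVol_inr (j : (thetaIndex X).Label) (pp : Nat.Primes) :
    factorMapDH X hlog j (.inr pp) ''
        (settingPrVol X hlog M archPk archSub Ψ act Mmod region n lat sig split qData thetaBox qCentre hq
          hfin).thetaRegion3 j (.inr pp) =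
      ⋃ m : ℤ, thetaBox m (thetaPilotObject sig split) j (.inr pp) := by
  rw [thetaRegion3_settingPrVol]
  exact Set.image_preimage_eq _ (factorMapDH_inr_surjective X hlog j pp)

/-! ## 2. `HullDefined`: unconditionally at `∞`, from BOUNDED and NONDEGENERATE Θ-boxes at a prime -/

/-- **`HullDefined` at `v_ℚ = ∞`, UNCONDITIONALLY** (empty field-factor index at the archimedean place: the modelling
choice of abc-iut-c312-5's `Cor312VolumesRealAssembly`, shared by `settingPrVol`). [claim: Mochizuki2012, status: disputed] -/
theorem hullDefined_settingPrVol_inl (j : (thetaIndex X).Label) (u : Unit) :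
    (settingPrVol X hlog M archPk archSub Ψ act Mmod region n lat sig split qData thetaBox qCentre hq
      hfin).HullDefined j (.inl u) := by
  refine ⟨isBounded_iff_forall_norm_le.2 ⟨0, fun z _ => (pi_norm_le_iff_of_nonneg le_rfl).2 fun s => s.elim⟩,
    fun s => s.elim⟩

/-- **`HullDefined` at `v_ℚ = p` from two conditions on the Θ-boxes** (twin of abc-iut-c312-5's
`hullDefined_settingDHVol_inr` for the packet-normalised volumes): if the union over `m` of the Θ-boxes of the
Θ-pilot object at `(j, p)` is BOUNDED (Dupuy–Hilado (4.10)) and NONDEGENERATE, then the union of ALL possible images of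
the Θ-pilot object at `(j, p)` is relatively compact and admits its holomorphic hull ([IUTchIII] proof of Cor. 3.12,
p. 175 l. 2–4 "compactness of the `^{1,∘}𝒰_{j,v_ℚ}`"). PROOF: the bounded union is absorbed by a log-shell lattice
`Π_{v⃗} c·I_{v⃗}` (`exists_latticeF_of_norm_le`), every (Ind1)/(Ind2) generator fixes `e⁻¹(Π_{v⃗} c·I_{v⃗})`
(`family_image_latticePk`), and this seat's `hullDefined_of_stable` applies with the bounded stable
`W = e⁻¹(Π_{v⃗} c·I_{v⃗})` — none of which reads the container's weights. [claim: Mochizuki2012, status: disputed] -/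
theorem hullDefined_settingPrVol_inr (j : (thetaIndex X).Label) (pp : Nat.Primes)
    (hbdd : Bornology.IsBounded (⋃ m : ℤ, thetaBox m (thetaPilotObject sig split) j (.inr pp)))
    (hnd : IsNondegenerate (factorFieldDH X hlog j (.inr pp))
      (⋃ m : ℤ, thetaBox m (thetaPilotObject sig split) j (.inr pp))) :
    (settingPrVol X hlog M archPk archSub Ψ act Mmod region n lat sig split qData thetaBox qCentre hq
      hfin).HullDefined j (.inr pp) := by
  haveI : Fact (pp : ℕ).Prime := ⟨pp.2⟩
  -- the bounded union of boxes is absorbed by a lattice `Π_{v⃗} c·I_{v⃗}`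
  obtain ⟨R, hR⟩ := isBounded_iff_forall_norm_le.1 hbdd
  obtain ⟨c, -, hcR⟩ := (presAt X hlog pp).exists_latticeF_of_norm_le (j := j) R
  have hsub : (⋃ m : ℤ, thetaBox m (thetaPilotObject sig split) j (.inr pp)) ⊆
      (presAt X hlog pp).latticeF j c :=
    fun z hz => hcR z fun s => (norm_le_pi_norm z s).trans (hR z hz)
  -- this seat's criterion with `W = e⁻¹(Π_{v⃗} c·I_{v⃗})`
  refine Setting.hullDefined_of_stable n lat sig split qData
    (realPiecesPr X hlog M archPk archSub Ψ act Mmod region thetaBox qCentre) hq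
    (hadm_Pr X hlog M archPk archSub Ψ act Mmod region n) hfin j (.inr pp) ((presAt X hlog pp).latticePk j c)
    (fun Φ hΦ => (presAt X hlog pp).family_image_latticePk hΦ j c) ?_ ?_ ?_
  · -- the (Ind3)-region lies in `W`
    intro x hx
    have hx' : factorMapDH X hlog j (.inr pp) x ∈ ⋃ m : ℤ, thetaBox m (thetaPilotObject sig split) j (.inr pp) := by
      change x ∈ (settingPrVol X hlog M archPk archSub Ψ act Mmod region n lat sig split qData thetaBox qCentre hq
        hfin).thetaRegion3 j (.inr pp) at hx
      rw [thetaRegion3_settingPrVol] at hx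
      exact hx
    have h2 := hsub hx'
    rw [← (presAt X hlog pp).preimage_latticeF_comparison c]
    exact h2
  · -- `e '' W = latticeF c` is bounded
    obtain ⟨R', hR'0, hR'⟩ := (presAt X hlog pp).exists_norm_le_of_mem_latticeF (j := j) c
    have himg : factorMapDH X hlog j (.inr pp) '' (presAt X hlog pp).latticePk j c =
        (presAt X hlog pp).latticeF j c :=
      (presAt X hlog pp).image_latticePk c
    refine isBounded_iff_forall_norm_le.2 ⟨R', fun z hz => (pi_norm_le_iff_of_nonneg hR'0).2 (hR' z ?_)⟩
    rw [← himg]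
    exact hz
  · -- the image of the (Ind3)-region is the union of the boxes, nondegenerate by hypothesis
    change IsNondegenerate (factorFieldDH X hlog j (.inr pp)) (factorMapDH X hlog j (.inr pp) ''
      (settingPrVol X hlog M archPk archSub Ψ act Mmod region n lat sig split qData thetaBox qCentre hq
        hfin).thetaRegion3 j (.inr pp))
    rw [image_thetaRegion3_settingPrVol_inr]
    exact hnd

/-- **`HullDefined` at every `(j, v_ℚ)`** from bounded nondegenerate Θ-boxes at the primes.
[claim: Mochizuki2012, status: disputed] -/
theorem hullDefined_settingPrVol (j : (thetaIndex X).Label)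
    (hbdd : ∀ pp : Nat.Primes, Bornology.IsBounded (⋃ m : ℤ, thetaBox m (thetaPilotObject sig split) j (.inr pp)))
    (hnd : ∀ pp : Nat.Primes, IsNondegenerate (factorFieldDH X hlog j (.inr pp))
      (⋃ m : ℤ, thetaBox m (thetaPilotObject sig split) j (.inr pp))) :
    ∀ vQ : (thetaIndex X).VQ,
      (settingPrVol X hlog M archPk archSub Ψ act Mmod region n lat sig split qData thetaBox qCentre hq
        hfin).HullDefined j vQ
  | .inl u => hullDefined_settingPrVol_inl X hlog M archPk archSub Ψ act Mmod region n lat sig split qData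
      thetaBox qCentre hq hfin j u
  | .inr pp => hullDefined_settingPrVol_inr X hlog M archPk archSub Ψ act Mmod region n lat sig split qData
      thetaBox qCentre hq hfin j pp (hbdd pp) (hnd pp)

/-- **The local Θ-volume is a real number at every `(j, v_ℚ)`** (not `+∞`: "`−|log(Θ)|` is finite" locally) for the
packet-normalised volumes. [claim: Mochizuki2012, status: disputed] -/
theorem thetaLocal_ne_top_settingPrVol (j : (thetaIndex X).Label)
    (hbdd : ∀ pp : Nat.Primes, Bornology.IsBounded (⋃ m : ℤ, thetaBox m (thetaPilotObject sig split) j (.inr pp)))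
    (hnd : ∀ pp : Nat.Primes, IsNondegenerate (factorFieldDH X hlog j (.inr pp))
      (⋃ m : ℤ, thetaBox m (thetaPilotObject sig split) j (.inr pp))) (vQ : (thetaIndex X).VQ) :
    (settingPrVol X hlog M archPk archSub Ψ act Mmod region n lat sig split qData thetaBox qCentre hq
      hfin).thetaLocal j vQ ≠ ⊤ := by
  unfold Setting.thetaLocal
  rw [if_pos (hullDefined_settingPrVol X hlog M archPk archSub Ψ act Mmod region n lat sig split qData thetaBox
    qCentre hq hfin j hbdd hnd vQ)]
  exact WithTop.coe_ne_top

/-- The hull `^{n,∘}𝒰_{j,v_ℚ}` of the union of the possible images is then an ADMISSIBLE region of the packet-normalised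
container (this seat's `thetaHull_adm`). [claim: Mochizuki2012, status: disputed] -/
theorem thetaHull_adm_settingPrVol (j : (thetaIndex X).Label)
    (hbdd : ∀ pp : Nat.Primes, Bornology.IsBounded (⋃ m : ℤ, thetaBox m (thetaPilotObject sig split) j (.inr pp)))
    (hnd : ∀ pp : Nat.Primes, IsNondegenerate (factorFieldDH X hlog j (.inr pp))
      (⋃ m : ℤ, thetaBox m (thetaPilotObject sig split) j (.inr pp))) (vQ : (thetaIndex X).VQ) :
    ((situationPrVol X hlog M archPk archSub Ψ act Mmod region).D n).Adm j vQ
      ((settingPrVol X hlog M archPk archSub Ψ act Mmod region n lat sig split qData thetaBox qCentre hq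
        hfin).thetaHull j vQ) :=
  (settingPrVol X hlog M archPk archSub Ψ act Mmod region n lat sig split qData thetaBox qCentre hq
    hfin).thetaHull_adm (hullDefined_settingPrVol X hlog M archPk archSub Ψ act Mmod region n lat sig split qData
      thetaBox qCentre hq hfin j hbdd hnd vQ)

/-! ## 3. Good primes: the hull of the union of the possible images is `e⁻¹(Π_{v⃗} (R_{v⃗})^∼)`, of volume `0` -/

/-- The log-volume of `e⁻¹(Π_{v⃗} (R_{v⃗})^∼)` in the PACKET-NORMALISED container VANISHES at every prime: every summand has
`log μ̄((R_{v⃗})^∼) = 0` (Dupuy–Hilado (3.6)), so the weighted sum is `0` whatever the weights.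
[cite: DupuyHilado2025, Def. 3.6.1] -/
theorem logvol_preimage_normalizedPacket_settingPrVol (j : (thetaIndex X).Label) (pp : Nat.Primes) :
    haveI : Fact (pp : ℕ).Prime := ⟨pp.2⟩
    ((situationPrVol X hlog M archPk archSub Ψ act Mmod region).D n).logvol j (.inr pp)
      ((presAtPr X hlog pp).comparison j ⁻¹' Set.pi univ fun e =>
        (normalizedPacket (pp : ℕ) ((presAtPr X hlog pp).kk e) : Set ((presAtPr X hlog pp).X e))) = 0 := by
  haveI : Fact (pp : ℕ).Prime := ⟨pp.2⟩
  haveI : Nonempty ((thetaIndex X).Caps j) := ⟨0⟩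
  refine ((realizes_situationPrVol X hlog M archPk archSub Ψ act Mmod region n).logvol_eq j (.inr pp) _).trans ?_
  have h := SummandPieces.logvol_preimage_pi (summandPiecesPr X hlog) j (.inr pp)
    (R := fun e => (normalizedPacket (pp : ℕ) ((presAtPr X hlog pp).kk e) : Set ((presAtPr X hlog pp).X e)))
    (fun e => (presAtPr X hlog pp).packetAdm_normalizedPacket_kk e)
  refine h.trans (Finset.sum_eq_zero fun e _ => ?_)
  show (summandPiecesPr X hlog).w j (.inr pp) e *
    packetLogμ (pp : ℕ) ((presAtPr X hlog pp).kk e) (normalizedPacket (pp : ℕ) ((presAtPr X hlog pp).kk e)) = 0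
  rw [packetLogμ_normalizedPacket, mul_zero]

/-- `e⁻¹(Π_{v⃗} (R_{v⃗})^∼)` through the probability-weighted presentation IS the same packet set as through abc-iut-c312-5's
(the two presentations share carriers, `φ_v` and the comparison; only the weights differ). [folklore] -/
theorem preimage_pi_normalizedPacket_presAtPr_eq (j : (thetaIndex X).Label) (pp : Nat.Primes) :
    haveI : Fact (pp : ℕ).Prime := ⟨pp.2⟩
    ((presAtPr X hlog pp).comparison j ⁻¹' Set.pi univ fun e =>
        (normalizedPacket (pp : ℕ) ((presAtPr X hlog pp).kk e) : Set ((presAtPr X hlog pp).X e))) =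
      (presAt X hlog pp).comparison j ⁻¹' Set.pi univ fun e =>
        (normalizedPacket (pp : ℕ) ((presAt X hlog pp).kk e) : Set ((presAt X hlog pp).X e)) :=
  rfl

/-- **At a GOOD prime the hull of the union of ALL possible images IS `e⁻¹(Π_{v⃗} I_{v⃗})`** for `settingPrVol`: for
`p > 2`, `p ∤ disc(F)` and `j ∈ 𝔽_l^⋇`, if the union of the Θ-boxes at `(j, p)` is the unit polydisc `𝒪_L`, then
`^{n,∘}𝒰_{j,p} = e⁻¹(Π_{v⃗} I_{v⃗})` ([IUTchIV] Thm. 1.10 Step (vi): "the “container of possible images” is precisely equal to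
the tensor product of log-shells") — the twin of abc-iut-c312-5's `thetaHull_settingDHVol_eq_of_good`, same proof
(the frames and the indeterminacy orbit do not read the weights). [cite: Mochizuki2012, IUTchIV Thm 1.10 proof Step (vi) p. 29] -/
theorem thetaHull_settingPrVol_eq_of_good (i : Fin (thetaIndex X).lstar) (pp : Nat.Primes)
    (hp2 : 2 < (pp : ℕ)) (hdisc : ¬ ((pp : ℕ) : ℤ) ∣ NumberField.discr F)
    (hbox : (⋃ m : ℤ, thetaBox m (thetaPilotObject sig split) (Setting.labelSucc i) (.inr pp)) =
      hullSet (factorFieldDH X hlog (Setting.labelSucc i) (.inr pp)) (fun _ => 1)) :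
    haveI : Fact (pp : ℕ).Prime := ⟨pp.2⟩
    (settingPrVol X hlog M archPk archSub Ψ act Mmod region n lat sig split qData thetaBox qCentre
          hq hfin).thetaHull (Setting.labelSucc i) (.inr pp) =
      (presAt X hlog pp).latticePk (Setting.labelSucc i) 1 := by
  haveI : Fact (pp : ℕ).Prime := ⟨pp.2⟩
  have hj := two_le_card_caps_labelSucc X i
  have he := absRamificationIdx_presAt_eq_one X hlog pp hdisc
  -- the lattice `Π I_v⃗` IS `𝒪_L` here
  have hΛ : (presAt X hlog pp).latticeF (Setting.labelSucc i) 1 =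
      hullSet (factorFieldDH X hlog (Setting.labelSucc i) (.inr pp)) (fun _ => 1) :=
    (presAt X hlog pp).latticeF_one_eq_hullSet_of_unramified hp2 hj he
  have hHul : Literature.IUT.LogVolume.IsHullSet (factorFieldDH X hlog (Setting.labelSucc i) (.inr pp))
      (hullSet (factorFieldDH X hlog (Setting.labelSucc i) (.inr pp)) (fun _ => 1)) :=
    ⟨fun _ => 1, fun _ => one_ne_zero, rfl⟩
  -- the (Ind3)-region is `e⁻¹(𝒪_L) = latticePk 1`
  have h3 :
      (settingPrVol X hlog M archPk archSub Ψ act Mmod region n lat sig split qData thetaBox qCentre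
        hq hfin).thetaRegion3 (Setting.labelSucc i) (.inr pp) = (presAt X hlog pp).latticePk (Setting.labelSucc i) 1 := by
    rw [thetaRegion3_settingPrVol, hbox]
    exact (preimage_factorMapDH_hullSet_one X hlog _ pp).trans
      ((presAt X hlog pp).latticePk_one_eq_of_unramified hp2 hj he).symm
  -- the union of the possible images has image `𝒪_L`
  have hU : factorMapDH X hlog (Setting.labelSucc i) (.inr pp) ''
      ⋃₀
          (settingPrVol X hlog M archPk archSub Ψ act Mmod region n lat sig split qData thetaBox qCentre
            hq hfin).possibleImages (Setting.labelSucc i) (.inr pp) =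
      hullSet (factorFieldDH X hlog (Setting.labelSucc i) (.inr pp)) (fun _ => 1) := by
    apply Set.Subset.antisymm
    · have hsub : ⋃₀
        (settingPrVol X hlog M archPk archSub Ψ act Mmod region n lat sig split qData thetaBox qCentre
          hq hfin).possibleImages (Setting.labelSucc i) (.inr pp) ⊆
          (presAt X hlog pp).latticePk (Setting.labelSucc i) 1 :=
        (settingPrVol X hlog M archPk archSub Ψ act Mmod region n lat sig split qData thetaBox qCentre
              hq hfin).sUnion_possibleImages_subset
          (fun Φ hΦ => (presAt X hlog pp).family_image_latticePk hΦ _ 1) h3.le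
      rintro _ ⟨x, hx, rfl⟩
      rw [← hΛ]
      exact ⟨(presAt X hlog pp).comparison _ x, hsub hx, rfl⟩
    · rw [← hbox, ← image_thetaRegion3_settingPrVol_inr
        X hlog M archPk archSub Ψ act Mmod region n lat sig split qData thetaBox qCentre hq hfin _ pp]
      exact Set.image_mono (
          (settingPrVol X hlog M archPk archSub Ψ act Mmod region n lat sig split qData thetaBox qCentre
            hq hfin).thetaRegion3_subset_sUnion _ _)
  have hb : Bornology.IsBounded (factorMapDH X hlog (Setting.labelSucc i) (.inr pp) ''
      ⋃₀
          (settingPrVol X hlog M archPk archSub Ψ act Mmod region n lat sig split qData thetaBox qCentre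
            hq hfin).possibleImages (Setting.labelSucc i) (.inr pp)) := by
    rw [hU]
    exact isBounded_hullSet _ _
  -- compute the hull through this seat's pulled-back real frame
  show ((HullFrame.ofLocalFields (factorFieldDH X hlog (Setting.labelSucc i) (.inr pp))).comap
      (factorMapDH X hlog (Setting.labelSucc i) (.inr pp))).hull
      (⋃₀
          (settingPrVol X hlog M archPk archSub Ψ act Mmod region n lat sig split qData thetaBox qCentre
            hq hfin).possibleImages (Setting.labelSucc i) (.inr pp)) = _
  rw [HullFrame.comap_hull _ _ hb, hU,
    HullFrame.ofLocalFields_hull_eq _ (isBounded_hullSet _ _) hHul.isNondegenerate, holomorphicHull_hullSet]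
  exact (preimage_factorMapDH_hullSet_one X hlog _ pp).trans
    ((presAt X hlog pp).latticePk_one_eq_of_unramified hp2 hj he).symm

/-- **At a GOOD prime the local Θ-volume of `settingPrVol` is `0`** (the hull is `e⁻¹(Π_{v⃗} (R_{v⃗})^∼)`, of log-volume
`0` in the packet-normalised container as well). [cite: Mochizuki2012, IUTchIV Thm 1.10 proof Step (vi) p. 29] -/
theorem thetaLocal_settingPrVol_eq_zero (i : Fin (thetaIndex X).lstar) (pp : Nat.Primes)
    (hp2 : 2 < (pp : ℕ)) (hdisc : ¬ ((pp : ℕ) : ℤ) ∣ NumberField.discr F)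
    (hbox : (⋃ m : ℤ, thetaBox m (thetaPilotObject sig split) (Setting.labelSucc i) (.inr pp)) =
      hullSet (factorFieldDH X hlog (Setting.labelSucc i) (.inr pp)) (fun _ => 1)) :
    (settingPrVol X hlog M archPk archSub Ψ act Mmod region n lat sig split qData thetaBox qCentre
          hq hfin).thetaLocal (Setting.labelSucc i) (.inr pp) = ((0 : ℝ) : WithTop ℝ) := by
  haveI : Fact (pp : ℕ).Prime := ⟨pp.2⟩
  have hHul : Literature.IUT.LogVolume.IsHullSet (factorFieldDH X hlog (Setting.labelSucc i) (.inr pp))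
      (hullSet (factorFieldDH X hlog (Setting.labelSucc i) (.inr pp)) (fun _ => 1)) :=
    ⟨fun _ => 1, fun _ => one_ne_zero, rfl⟩
  have hHD :
      (settingPrVol X hlog M archPk archSub Ψ act Mmod region n lat sig split qData thetaBox qCentre
        hq hfin).HullDefined (Setting.labelSucc i) (.inr pp) :=
    hullDefined_settingPrVol_inr
        X hlog M archPk archSub Ψ act Mmod region n lat sig split qData thetaBox qCentre hq hfin _ pp
      (by rw [hbox]; exact isBounded_hullSet _ _) (by rw [hbox]; exact hHul.isNondegenerate)
  unfold Setting.thetaLocal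
  rw [if_pos hHD, thetaHull_settingPrVol_eq_of_good
      X hlog M archPk archSub Ψ act Mmod region n lat sig split qData thetaBox qCentre hq hfin i pp hp2 hdisc hbox,
    (presAt X hlog pp).latticePk_one_eq_of_unramified hp2 (two_le_card_caps_labelSucc X i)
      (absRamificationIdx_presAt_eq_one X hlog pp hdisc),
    ← preimage_pi_normalizedPacket_presAtPr_eq X hlog (Setting.labelSucc i) pp]
  exact congrArg _ (logvol_preimage_normalizedPacket_settingPrVol X hlog M archPk archSub Ψ act Mmod region n
    (Setting.labelSucc i) pp)

/-! ## 4. `ThetaFinite` -/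

/-- **`ThetaFinite` for the real setting with the PACKET-NORMALISED verbatim volumes, from three Θ-box conditions**:
bounded and nondegenerate boxes at every `(j ∈ 𝔽_l^⋇, p)` (⇒ every local Θ-volume is a real number, §2), and boxes
equal to the unit polydisc off a finite prime set (⇒ zero local Θ-volume at every further prime not dividing
`2·disc(F)`, §3, so the global sum of [IUTchIII] Prop. 3.9 (iii) is a finite sum) — the twin of abc-iut-c312-5's
`thetaFinite_settingDHVol`, with the SAME hypotheses. [claim: Mochizuki2012, status: disputed] -/
theorem thetaFinite_settingPrVol
    (hbdd : ∀ (i : Fin (thetaIndex X).lstar) (pp : Nat.Primes),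
      Bornology.IsBounded (⋃ m : ℤ, thetaBox m (thetaPilotObject sig split) (Setting.labelSucc i) (.inr pp)))
    (hnd : ∀ (i : Fin (thetaIndex X).lstar) (pp : Nat.Primes),
      IsNondegenerate (factorFieldDH X hlog (Setting.labelSucc i) (.inr pp))
        (⋃ m : ℤ, thetaBox m (thetaPilotObject sig split) (Setting.labelSucc i) (.inr pp)))
    (hcof : ∀ i : Fin (thetaIndex X).lstar, {pp : Nat.Primes |
      (⋃ m : ℤ, thetaBox m (thetaPilotObject sig split) (Setting.labelSucc i) (.inr pp)) ≠
        hullSet (factorFieldDH X hlog (Setting.labelSucc i) (.inr pp)) (fun _ => 1)}.Finite) :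
    (settingPrVol X hlog M archPk archSub Ψ act Mmod region n lat sig split qData thetaBox qCentre
          hq hfin).ThetaFinite := by
  refine ⟨fun i vQ => thetaLocal_ne_top_settingPrVol
      X hlog M archPk archSub Ψ act Mmod region n lat sig split qData thetaBox qCentre hq hfin (Setting.labelSucc i)
      (hbdd i) (hnd i) vQ,
    fun i => ?_⟩
  have hD : 2 * (NumberField.discr F).natAbs ≠ 0 :=
    mul_ne_zero two_ne_zero (Int.natAbs_ne_zero.2 (NumberField.discr_ne_zero F))
  refine ((Set.finite_range Sum.inl).union (((finite_primes_dvd hD).union (hcof i)).image Sum.inr)).subset ?_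
  intro vQ hvQ
  rcases vQ with u | pp
  · exact Or.inl ⟨u, rfl⟩
  · refine Or.inr ⟨pp, ?_, rfl⟩
    by_contra hpp
    simp only [Set.mem_union, Set.mem_setOf_eq, not_or, ne_eq, not_not] at hpp
    obtain ⟨hp2, hdisc⟩ := good_of_not_dvd (F := F) pp hpp.1
    have h0 : (
        (settingPrVol X hlog M archPk archSub Ψ act Mmod region n lat sig split qData thetaBox qCentre
          hq hfin).thetaLocal (Setting.labelSucc i) (.inr pp)).untopD 0 = 0 := by
      rw [thetaLocal_settingPrVol_eq_zero
          X hlog M archPk archSub Ψ act Mmod region n lat sig split qData thetaBox qCentre hq hfin i pp hp2 hdisc hpp.2,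
        WithTop.untopD_coe]
    exact absurd h0 hvQ

end Setting

end Real

end Thm311

end IUTFork

end Summit.ABC

end
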